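import Summits.BirchSwinnertonDyer.BirchSwinnertonDyer.Theorems.ClassRecordThreeEulerHalvesAtThreeJetchev

/-!
# Rung K2@3, routes `KolyvaginRoadThree` ∕ `ClassRecordThree`: the REFINED KOLYVAGIN CONJECTURE at `3 ∥ N`
# (`M_∞ = t`, both halves, at every Manin-good frame) DECIDES `BSD(E,3)` on ALL of X11b ∧ (ram) — atom A1 AND
# the Tamagawa atom (T2′) at once (cell `bsd-stepL`, seat `bsd-stepL-tam3-p1`; `--supports
# stmt-BirchSwinnertonDyer-19109 --as helper`; also serves 19153 ∕ 19154 ∕ 19155 of `KolyvaginRoadThree`)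

koly's glue `Koly.bsdp_three_onA1_of_kolyvaginFrames` (`ClassRecordThreeKolyGlue.lean`, p410690) proves
`BSD(E,3)` on atom A1 = X11b@3 ∧ (ram) ∧ `3 ∤ ∏c` from Kolyvagin's conjecture mod 3 at every Manin-good frame
(`M_∞ = 0`), McCallum's structure theorem and the published inputs; its upper half is Kolyvagin's bound,
which on the Tamagawa atom (T2′) = (ram) ∧ `3 ∣ ∏c` loses the term `2t`, `t = ord₃ ∏_ℓ c_ℓ(E)`. File 1 of this
seat (`ClassRecordThreeEulerHalvesAtThreeJetchev.lean`, p419384) repaired exactly that loss from the JETCHEV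
DIRECTION `M_∞ ≥ t` (global `3^s`-divisibility of the derived Heegner points to depth `t`) through McCallum's
Cor. 5.6 upper form (p418283). Putting koly's LOWER consumer (`indexLowerBoundAt_of_certificateAt_of_mccallum`:
a level-`≤ t+1` certificate, i.e. `M_∞ ≤ t`) next to it:

* §8 `bsdp_three_of_certificateAt_of_globalDivisibility` — AT ONE odd Heegner datum of a pair of X11b@3 ∧
  (ram): a Kolyvagin certificate of level `M+1`, `M ≤ t`, on the frame (koly's `Koly.CertificateAt Dt β ι 3 M`)
  AND global divisibility to depth `t` on the same frame, plus McCallum's Cor. 5.6 (both one-sided facts) and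
  the published inputs ⟹ `BSDp W 3`. No `3 ∤ ∏c`, no Schneider, no BDP ∕ main conjecture, no Hsieh descent.
* §9 `bsdp_three_of_classX11b_of_ram_of_refinedKolyvaginFrames` — CLASS LEVEL: for every `(E,3) ∈` X11b with
  a (ram) witness, `BSDp W 3` from the published named facts (GZ, Kolyvagin, Skinner Thm C, GZK, modularity,
  newforms, Hoffstein–Luo, Mazur, Shimura reciprocity, Darmon 3.6, McCallum ×2) and TWO open ∀-frame inputs:
  **Z₃ᵗ** (`hZt`: a certificate of level `≤ t+1` at every Manin-good conductor-`1` frame — the frame form of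
  koly's HOME-typed `Koly.ZhangAtThreeTamagawa`, = `Koly.ZhangAtThreeSharpFrame` on A1) and **J₃ʳ** (`hJ`, file
  1). Together Z₃ᵗ ∧ J₃ʳ = «`M_∞ = t` at 3 ∥ N on (ram) ∧ surj frames» — W. Zhang's refined Kolyvagin
  conjecture ∕ Jetchev Conj. 1.3 ∕ BCGS Thm. 2's statement, at a prime every print excludes.
* §10 `globalDivisibility_of_padicValNat_tamagawaProduct_eq_zero` — on A1 (`t = 0`) the binder J₃ʳ is
  AUTOMATIC (depth `0`), so §9 restricted to A1 is p410690 with `hZ` in certificate form: the refined conjecture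
  is ONE object for the whole (ram) locus (1 116 + 567 TRUE-OPEN classes), replacing on (T2′) the inputs
  `SchneiderTamAtThree` (19154), `HalvesTamAtThree` (19155), the (ram) part of `HsiehDescentAtThree` (19108)
  and the (ram) clauses of `EulerHalvesAtThree` (19109) of route `KolyvaginRoadThree` — a re-cut the PLANNER
  may or may not want (honest caveat: on the 407 multi-carrier classes J₃ʳ is IMC-grade, HOME
  `tam3/MEMO-J3-v0.md` §4; Z₃ᵗ on (T2′) is koly's MEMO-v6 Part C blueprint with two gaps).

HONEST FRAMING. Hypothesis-shaped binders; nothing asserted about Z₃ᵗ or J₃ʳ; no item closes; nothing booked;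
CONDITIONAL on every binder listed in each theorem.

References: [McCallumLMS1991] §5 Lemma 5.1, Cor. 5.6; [Jetchev2008] Conj. 1.3; [WZhang2014] Thm. 1.1, Thm. 10.2,
Remark 18; [BurungaleEtAl2026] Thm. 2 (shape); [JetchevSkinnerWan2017] §7.4.2; [Skinner2016PacificMC] Thm. C;
[GrossLMS1991] §4 (4.1); [Darmon2004] Thm. 3.6; files p409453, p410016, p410690 (koly), p418283, p419384 (this seat).
-/

noncomputable section

open scoped Classical

namespace Summit.BirchSwinnertonDyer.Rank1Residual.X11b.Three.Koly

open WeierstrassCurve Literature.NumberTheory.EllipticCurves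
  Literature.NumberTheory.EllipticCurves.ModularForms
  Literature.NumberTheory.EllipticCurves.Rank1Residual
  Summit.BirchSwinnertonDyer.Rank1Residual Summit.BirchSwinnertonDyer.Rank1Residual.X11b

/-! ### §8 At one odd Heegner datum: certificate (M_∞ ≤ t) + global divisibility (M_∞ ≥ t) ⟹ BSD(E,3) -/

/-- **The refined Kolyvagin conjecture at ONE frame decides `BSD(E,3)` for a pair of X11b@3 ∧ (ram).** Data:
`(E,3) ∈` X11b (`ClassX11b W 3`) with a (ram) witness; an imaginary quadratic `K` with ODD `d_K`, Heegner for
`N_E`, `L(E^{d_K},1) ≠ 0`, a minimal model `Wd` of the twist; a Manin-good frame `(Dt, H, ι)` (`3 ∤ c(Dt)`)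
with Heegner point `P ↦ heegnerPointComplex Dt H`; a conductor-`1` Kolyvagin–Heegner datum `d₁` on
`(Dt, H.β, ι)` whose derived point is `P` in `E(K̄)`. Published inputs: Gross–Zagier, Kolyvagin, Skinner 2016
Thm. C, GZK, modularity (`hGZ hKo hSk hGZK hmod`), McCallum Cor. 5.6 in its two one-sided forms (`hMc` lower ∕
certificate, `hMcU` upper ∕ divisibility). THE TWO INPUTS OF THE REFINED CONJECTURE AT THE FRAME: a
certificate `CertificateAt Dt H.β ι 3 M` with `M ≤ t := ord₃ ∏c_ℓ(E)` (`hcert`, `hMt`: `M_∞ ≤ t`) and global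
`3^s`-divisibility of all derived points on the frame for `s ≤ t` (`hglob`: `M_∞ ≥ t`). CONCLUSION: `BSDp W 3`.
Proof: `ρ̄₃` onto (irr + ram), tower surjectivity (Tate line), non-CM, `d_K ∉ {−3,−4}`, rank one and `Ш(E/K)`
finite (Kolyvagin), no `3`-torsion (irreducibility), `3^{M₀} ∥ P` (Mordell–Weil); LOWER: koly's
`indexLowerBoundAt_of_certificateAt_of_mccallum` ⟹ `IndexLowerBoundAt W 3 K P` ⟹ `Typed.MissingLowerBoundAt`
(`halves_of_heegnerData_of_odd`, GZ bookkeeping + Skinner Thm. C for the twist); UPPER: file 1 §1 ⟹ the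
sharpened bound over `K` ⟹ `Typed.MissingUpperBoundAt` (`missingUpperBoundAt_of_sharpIndexBound_of_le`);
`bsdp_of_halves`. CONDITIONAL on every binder; nothing booked.
[cite: McCallumLMS1991, §5 Cor. 5.6 (p. 310) and Lemma 5.1 (p. 303)] [cite: WZhang2014, Thm. 10.2 and Remark 18 (pp. 245–246)]
[cite: Jetchev2008, Conj. 1.3 (p. 812)] [cite: JetchevSkinnerWan2017, §7.4.1–7.4.2 (pp. 30–31)]
[cite: Skinner2016PacificMC, Thm. C (§1) and footnote 1] -/
theorem bsdp_three_of_certificateAt_of_globalDivisibility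
    (W : WeierstrassCurve ℚ) [W.IsElliptic] [W.IsGloballyMinimal] [NeZero (W.conductorNorm ℤ)]
    (K : Type) [Field K] [NumberField K]
    (Dt : ModularParametrizationData W (W.conductorNorm ℤ))
    (H : HeegnerDatum (W.conductorNorm ℤ) (NumberField.discr K)) (ι : K →+* ℂ)
    (P : (W.baseChange K).toAffine.Point)
    -- published inputs (named facts of the tree)
    (hGZ : gross_zagier (W.conductorNorm ℤ) W K) (hKo : kolyvagin (W.conductorNorm ℤ) W K)
    (hSk : Skinner2016.thmC_padicValRat_bsd_rank_zero)
    (hGZK : rank_eq_analyticRank_of_analyticRank_le_one) (hmod : hasEntireLFunction_rat)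
    (hMc : McCallum1991_pow_dvd_card_sha_primary_of_certificate)
    (hMcU : McCallum1991_padicValNat_card_sha_primary_add_le_of_globalDivisibility)
    -- the pair
    (hX : ClassX11b W 3) (hram : Ram W 3)
    -- ONE odd Heegner datum with a Manin-good frame
    (hK : IsImaginaryQuadratic K) (hodd : Odd (NumberField.discr K))
    (hHN : SatisfiesHeegnerHypothesis (W.conductorNorm ℤ) K)
    (hP : WeierstrassCurve.Affine.Point.map ι.toRatAlgHom P = heegnerPointComplex Dt H)
    (hc : ¬ (3 : ℤ) ∣ Dt.c)
    (hLt : (W.quadraticTwist (NumberField.discr K : ℚ)).entireLFunction 1 ≠ 0)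
    (Wd : WeierstrassCurve ℚ) [Wd.IsElliptic] [Wd.IsGloballyMinimal] (Cd : VariableChange ℚ)
    (hWd : Cd • W.quadraticTwist (NumberField.discr K : ℚ) = Wd)
    -- a conductor-1 Kolyvagin–Heegner datum on the frame, descending to P
    (d₁ : KolyvaginHeegnerData Dt H.β ι 1)
    (hPd : d₁.toGeomPoints d₁.derivedPoint = toGeomPoints (W.baseChange K) P)
    -- THE REFINED KOLYVAGIN CONJECTURE AT THE FRAME: M_∞ ≤ t (certificate) and M_∞ ≥ t (divisibility)
    {M : ℕ} (hcert : CertificateAt Dt H.β ι 3 M) (hMt : M ≤ padicValNat 3 W.tamagawaProduct)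
    (hglob : ∀ (s : ℕ), s ≤ padicValNat 3 W.tamagawaProduct →
      ∀ (n : ℕ) (d : KolyvaginHeegnerData Dt H.β ι n), Squarefree n →
        (∀ ℓ ∈ n.primeFactors, Zhang2014.IsKolyvaginPrime (W.conductorNorm ℤ) W K 3 ℓ ∧
          s ≤ Zhang2014.kolyvaginIndex W 3 ℓ) → PDiv d 3 s) :
    BSDp W 3 := by
  haveI : Fact (Nat.Prime 3) := ⟨Nat.prime_three⟩
  obtain ⟨hr, h32, hmult, hirr⟩ := hX
  have hρ : Surj W 3 := surj_of_irr_of_ram W 3 hirr hram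
  have hsurj : ∀ m : ℕ, W.HasSurjectiveModNGaloisRep (3 ^ m : ℕ) :=
    Rank1Residual.surjective_pow_three_of_mult_of_tateLine W hmult hρ
  have hCM : ¬ W.HasCM := not_hasCM_of_hasMultiplicativeReductionAtPrime' W hmult
  -- `3 ∣ N` splits in `K`: `3 ∤ d_K`, `3 ∤ #𝓞_K^×`; `d_K ∉ {−3, −4}`
  obtain ⟨h3d, hμ⟩ := not_dvd_discr_and_not_dvd_torsionOrder_of_heegner hK hHN (p := 3) (by decide)
    (dvd_conductorNorm_of_classX11b ⟨hr, h32, hmult, hirr⟩)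
  have h3 : NumberField.discr K ≠ -3 := by
    intro h
    exact h3d (h ▸ ⟨-1, by norm_num⟩)
  have h4 : NumberField.discr K ≠ -4 := by
    intro h
    rw [h] at hodd
    exact (Int.not_odd_iff_even.mpr ⟨-2, by norm_num⟩) hodd
  -- y_K non-torsion; rank one, Ш(E/K) finite (Kolyvagin); no 3-torsion (irreducibility)
  have hPinf : ¬ IsOfFinAddOrder P :=
    not_isOfFinAddOrder_of_heegner_of_analyticRank_eq_one W (W.conductorNorm ℤ) K Dt H ι P hGZ hmod hr hK
      hHN hLt hP
  obtain ⟨hrank, hSha⟩ := hKo hK hHN ⟨Dt, H, ι, hP⟩ hPinf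
  haveI : Finite (W.baseChange K).sha := hSha
  have hbot := torsionBy_eq_bot_of_isImaginaryQuadratic_of_hasIrreducibleModPGaloisRep W K hK
    Nat.prime_three hirr
  have hiv : ∀ x : (W.baseChange K).toAffine.Point, 3 • x = 0 → x = 0 := fun x hx ↦ by
    have hmem : x ∈ AddSubgroup.torsionBy (W.baseChange K).toAffine.Point ((3 : ℕ) : ℤ) := by
      rw [mem_torsionBy_iff, natCast_zsmul]
      exact hx
    rw [hbot] at hmem
    exact hmem
  -- the exponent 3^{M₀} ∥ P (Mordell–Weil)
  haveI : Module.Finite ℤ (W.baseChange K).toAffine.Point := (W.baseChange K).module_finite_point_holds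
  obtain ⟨M₀, x₀, hx₀, hmax⟩ := exists_pow_smul_eq_and_forall_ne hPinf (p := 3) (by norm_num)
  have hdiv : ∃ Q : (W.baseChange K).toAffine.Point, ((3 ^ M₀ : ℕ) : ℤ) • Q = P :=
    ⟨x₀, by rw [natCast_zsmul]; exact hx₀⟩
  have hndiv : ¬ ∃ Q : (W.baseChange K).toAffine.Point, ((3 ^ (M₀ + 1) : ℕ) : ℤ) • Q = P := by
    rintro ⟨Q, hQ⟩
    exact hmax Q (by rw [← natCast_zsmul]; exact hQ)
  -- LOWER: the certificate gives STEP L in index currency (koly), hence the lower half (GZ bookkeeping)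
  have hL : IndexLowerBoundAt W 3 K P :=
    indexLowerBoundAt_of_certificateAt_of_mccallum W K hMc hCM hK h3 h4 hHN 3 (by norm_num) hsurj Dt H.β ι
      d₁ P hPd hPinf hrank hiv hdiv hndiv hcert hMt
  have hhalves := halves_of_heegnerData_of_odd W 3 K Dt H ι P hGZ hKo hSk hGZK hmod hr h32 hmult hirr hram
    hK hodd h3d hHN hP hc hμ hLt Wd Cd hWd
  have hlower : Typed.MissingLowerBoundAt W 3 := hhalves.1 hL
  -- UPPER: global divisibility gives the Tamagawa-sharpened bound over K (file 1 §1), hence the upper half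
  have hU : Finite (W.baseChange K).sha → ¬ IsOfFinAddOrder P →
      padicValNat 3 (Nat.card (W.baseChange K).sha) + 2 * padicValNat 3 W.tamagawaProduct ≤
        2 * padicValNat 3 (AddSubgroup.zmultiples P).index :=
    fun _ _ ↦ shaIndexBound_sharp_three_of_globalDivisibility hMcU W K hmult hρ hK h3 h4 hHN Dt H.β ι d₁ P
      hPd hPinf hrank hiv hglob
  have hupper : Typed.MissingUpperBoundAt W 3 :=
    missingUpperBoundAt_of_sharpIndexBound_of_le W 3 K Dt H ι P hGZ hKo hSk hGZK hmod hr h32 hmult hirr hram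
      hK hodd h3d hHN hP hc hμ hLt Wd Cd hWd (padicValNat 3 W.tamagawaProduct) le_rfl hU
  exact bsdp_of_halves hGZK W 3 (le_of_eq hr) hlower hupper

/-! ### §9 Class level: the refined Kolyvagin conjecture at every Manin-good frame ⟹ BSD(E,3) on X11b ∧ (ram) -/

/-- **`BSD(E,3)` on ALL of X11b@3 ∧ (ram) — A1 and the Tamagawa atom alike — from the REFINED KOLYVAGIN
CONJECTURE at `3 ∥ N` (both halves, ∀-frame form) and the published inputs.** For every `E/ℚ` globally
minimal with `(E,3) ∈` X11b and a (ram) witness: `BSDp W 3`. Published named facts: `hGZ hKo hSk hGZK hmod hnf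
hHL hMaz` (as in koly's glue), Shimura reciprocity at conductor `1` (`hrec`), Darmon 2004 Thm. 3.6 (`hD36`,
which discharges koly's seam G-a), McCallum's Cor. 5.6 in both one-sided forms (`hMc`, `hMcU`). OPEN inputs
(hypothesis shapes, nothing asserted): **Z₃ᵗ** `hZt` — at every Manin-good conductor-`1` frame of a
multiplicative-at-`3`, `ρ̄₃`-surjective, (ram) curve over an imaginary quadratic Heegner `K` with `d_K ≠ −3`, a
Kolyvagin certificate of level `M + 1` for some `M ≤ t = ord₃ ∏c_ℓ(E)` (`M_∞ ≤ t`; on A1 this is Kolyvagin's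
conjecture mod 3 = `Koly.ZhangAtThreeSharpFrame` read through `certificateAt_zero_of_kolyvaginClass_one_ne_zero`);
**J₃ʳ** `hJ` — the Jetchev direction on the same frames (`M_∞ ≥ t`; automatic on A1, §10). Proof: the odd
Hoffstein–Luo datum (`exists_oddHeegnerData`), the conductor-`1` datum (Darmon) with bottom point `y_K`
(Shimura reciprocity), then §8. CONDITIONAL on every binder; nothing booked; no item closes.
[cite: McCallumLMS1991, §5 Cor. 5.6 (p. 310)] [cite: WZhang2014, Thm. 1.1 (p. 195) and Thm. 10.2 (p. 245) — shape]
[cite: Jetchev2008, Conj. 1.3 (p. 812)] [cite: GrossLMS1991, §4 (4.1)] [cite: Darmon2004, Thm. 3.6 (PDF p. 43)]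
[cite: JetchevSkinnerWan2017, §7.4.1–7.4.2 (pp. 30–31)] -/
theorem bsdp_three_of_classX11b_of_ram_of_refinedKolyvaginFrames
    -- published named facts
    (hGZ : ∀ (N : ℕ) [NeZero N] (W : WeierstrassCurve ℚ) (K : Type) [Field K] [NumberField K],
      gross_zagier N W K)
    (hKo : ∀ (N : ℕ) [NeZero N] (W : WeierstrassCurve ℚ) (K : Type) [Field K] [NumberField K],
      kolyvagin N W K)
    (hSk : Skinner2016.thmC_padicValRat_bsd_rank_zero)
    (hGZK : rank_eq_analyticRank_of_analyticRank_le_one) (hmod : hasEntireLFunction_rat)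
    (hnf : exists_isNewformOf) (hHL : HoffsteinLuo1997_exists_twist_L_one_ne_zero)
    (hMaz : mazur_not_dvd_maninConstant_of_odd)
    (hrec : ∀ (N : ℕ) [NeZero N] (W : WeierstrassCurve ℚ) (K : Type) [Field K] [NumberField K],
      heegnerPointOfConductor_one_galoisConj N W K)
    (hD36 : ∀ (N : ℕ) [NeZero N] (W : WeierstrassCurve ℚ) (K : Type) [Field K] [NumberField K],
      phi_heegnerTau_mem_singularModuliField N W K)
    (hMc : McCallum1991_pow_dvd_card_sha_primary_of_certificate)
    (hMcU : McCallum1991_padicValNat_card_sha_primary_add_le_of_globalDivisibility)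
    -- OPEN INPUT Z₃ᵗ: a level-(≤ t+1) Kolyvagin certificate at every Manin-good frame (M_∞ ≤ t)
    (hZt : ∀ (W : WeierstrassCurve ℚ) [W.IsElliptic] [W.IsGloballyMinimal] [NeZero (W.conductorNorm ℤ)]
      (K : Type) [Field K] [NumberField K]
      (Dt : ModularParametrizationData W (W.conductorNorm ℤ)) (β : ℤ) (ι : K →+* ℂ),
      W.HasMultiplicativeReductionAtPrime 3 → Surj W 3 → Ram W 3 →
      IsImaginaryQuadratic K → SatisfiesHeegnerHypothesis (W.conductorNorm ℤ) K →
      NumberField.discr K ≠ -3 →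
      (4 * (W.conductorNorm ℤ : ℤ)) ∣ β ^ 2 - NumberField.discr K → ¬ (3 : ℤ) ∣ Dt.c →
      ∃ M : ℕ, M ≤ padicValNat 3 W.tamagawaProduct ∧ CertificateAt Dt β ι 3 M)
    -- OPEN INPUT J₃ʳ: global 3^s-divisibility to depth t at every Manin-good frame (M_∞ ≥ t)
    (hJ : ∀ (W : WeierstrassCurve ℚ) [W.IsElliptic] [W.IsGloballyMinimal] [NeZero (W.conductorNorm ℤ)]
      (K : Type) [Field K] [NumberField K]
      (Dt : ModularParametrizationData W (W.conductorNorm ℤ)) (β : ℤ) (ι : K →+* ℂ),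
      W.HasMultiplicativeReductionAtPrime 3 → Surj W 3 → Ram W 3 →
      IsImaginaryQuadratic K → SatisfiesHeegnerHypothesis (W.conductorNorm ℤ) K →
      NumberField.discr K ≠ -3 →
      (4 * (W.conductorNorm ℤ : ℤ)) ∣ β ^ 2 - NumberField.discr K → ¬ (3 : ℤ) ∣ Dt.c →
      ∀ (s : ℕ), s ≤ padicValNat 3 W.tamagawaProduct →
        ∀ (n : ℕ) (d : KolyvaginHeegnerData Dt β ι n), Squarefree n →
          (∀ ℓ ∈ n.primeFactors, Zhang2014.IsKolyvaginPrime (W.conductorNorm ℤ) W K 3 ℓ ∧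
            s ≤ Zhang2014.kolyvaginIndex W 3 ℓ) → PDiv d 3 s)
    -- the pair
    (W : WeierstrassCurve ℚ) [W.IsElliptic] [W.IsGloballyMinimal]
    (hX : ClassX11b W 3) (hram : Ram W 3) : BSDp W 3 := by
  haveI : NeZero (W.conductorNorm ℤ) := ⟨(W.conductorNorm_pos_holds).ne'⟩
  have hmult : W.HasMultiplicativeReductionAtPrime 3 := hX.2.2.1
  have hirr : Irr W 3 := hX.2.2.2
  have hρ : Surj W 3 := surj_of_irr_of_ram W 3 hirr hram
  -- ONE odd Heegner datum with a Manin-good frame (Hoffstein–Luo field; Mazur; w_K = 2)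
  obtain ⟨K, _, _, Dt, H, ι, P, Wd, _, _, Cd, hK, hodd, h3d, hHN, hP, hc, hμ, hLt, hWd⟩ :=
    exists_oddHeegnerData hnf hHL hMaz integral_neronScaling_of_isGloballyMinimal_holds W 3 hX.1
      (by decide) hmult hirr
  have h3 : NumberField.discr K ≠ -3 := by
    intro h
    exact h3d (h ▸ ⟨-1, by norm_num⟩)
  -- the conductor-1 datum on the frame (Darmon 3.6) and its bottom point (Shimura reciprocity)
  obtain ⟨d₁⟩ := exists_kolyvaginHeegnerData_one (hD36 _ W K) hK Dt H.β ι H.dvd_sq_sub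
  have hPd : d₁.toGeomPoints d₁.derivedPoint = toGeomPoints (W.baseChange K) P :=
    KolyvaginBottom.toGeomPoints_derivedPoint_one_eq (hrec _ W K) hK hHN hP d₁ rfl
  -- the refined conjecture at this frame
  obtain ⟨M, hMt, hcert⟩ := hZt W K Dt H.β ι hmult hρ hram hK hHN h3 H.dvd_sq_sub hc
  exact bsdp_three_of_certificateAt_of_globalDivisibility W K Dt H ι P (hGZ _ W K) (hKo _ W K) hSk hGZK hmod
    hMc hMcU hX hram hK hodd hHN hP hc hLt Wd Cd hWd d₁ hPd hcert hMt
    (hJ W K Dt H.β ι hmult hρ hram hK hHN h3 H.dvd_sq_sub hc)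

/-! ### §10 On A1 the Jetchev binder is automatic (depth 0) -/

/-- **At depth `t = 0` global divisibility is vacuous**: `3^0 ∣ P_n` always (`pDiv_zero`). So on atom A1
(`3 ∤ ∏c_ℓ(E)`) the binder J₃ʳ of §9 holds for free and §9 is koly's `bsdp_three_onA1_of_kolyvaginFrames` with
Kolyvagin's conjecture in certificate form: the refined conjecture is ONE object on the whole (ram) locus.
Bookkeeping. [cite: McCallumLMS1991, §5 (p. 303), `p^M | P_n`] -/
theorem globalDivisibility_of_padicValNat_tamagawaProduct_eq_zero
    {W : WeierstrassCurve ℚ} [W.IsGloballyMinimal] [NeZero (W.conductorNorm ℤ)]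
    {K : Type} [Field K] [NumberField K]
    {Dt : ModularParametrizationData W (W.conductorNorm ℤ)} {β : ℤ} {ι : K →+* ℂ}
    (ht : padicValNat 3 W.tamagawaProduct = 0) :
    ∀ (s : ℕ), s ≤ padicValNat 3 W.tamagawaProduct →
      ∀ (n : ℕ) (d : KolyvaginHeegnerData Dt β ι n), Squarefree n →
        (∀ ℓ ∈ n.primeFactors, Zhang2014.IsKolyvaginPrime (W.conductorNorm ℤ) W K 3 ℓ ∧
          s ≤ Zhang2014.kolyvaginIndex W 3 ℓ) → PDiv d 3 s := by
  intro s hs n d _ _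
  have hs0 : s = 0 := by omega
  subst hs0
  exact pDiv_zero d 3

/-- **… hence on A1 a level-1 certificate alone decides `BSD(E,3)` at one odd datum** (koly's p410016
`ClassX11b.bsdp_three_of_kolyvaginClass_one_ne_zero_of_mccallum` re-derived through §8 with the certificate
packaged and the upper fact carried — bookkeeping that §8 specialises correctly; `hMcU` is used vacuously).
CONDITIONAL on the binders. [cite: McCallumLMS1991, §5 Cor. 5.6 (p. 310)] [cite: WZhang2014, Thm. 1.1 (p. 195) — shape] -/
theorem bsdp_three_of_certificateAt_zero_of_not_dvd
    (W : WeierstrassCurve ℚ) [W.IsElliptic] [W.IsGloballyMinimal] [NeZero (W.conductorNorm ℤ)]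
    (K : Type) [Field K] [NumberField K]
    (Dt : ModularParametrizationData W (W.conductorNorm ℤ))
    (H : HeegnerDatum (W.conductorNorm ℤ) (NumberField.discr K)) (ι : K →+* ℂ)
    (P : (W.baseChange K).toAffine.Point)
    (hGZ : gross_zagier (W.conductorNorm ℤ) W K) (hKo : kolyvagin (W.conductorNorm ℤ) W K)
    (hSk : Skinner2016.thmC_padicValRat_bsd_rank_zero)
    (hGZK : rank_eq_analyticRank_of_analyticRank_le_one) (hmod : hasEntireLFunction_rat)
    (hMc : McCallum1991_pow_dvd_card_sha_primary_of_certificate)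
    (hMcU : McCallum1991_padicValNat_card_sha_primary_add_le_of_globalDivisibility)
    (hX : ClassX11b W 3) (hram : Ram W 3) (htam : ¬ 3 ∣ W.tamagawaProduct)
    (hK : IsImaginaryQuadratic K) (hodd : Odd (NumberField.discr K))
    (hHN : SatisfiesHeegnerHypothesis (W.conductorNorm ℤ) K)
    (hP : WeierstrassCurve.Affine.Point.map ι.toRatAlgHom P = heegnerPointComplex Dt H)
    (hc : ¬ (3 : ℤ) ∣ Dt.c)
    (hLt : (W.quadraticTwist (NumberField.discr K : ℚ)).entireLFunction 1 ≠ 0)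
    (Wd : WeierstrassCurve ℚ) [Wd.IsElliptic] [Wd.IsGloballyMinimal] (Cd : VariableChange ℚ)
    (hWd : Cd • W.quadraticTwist (NumberField.discr K : ℚ) = Wd)
    (d₁ : KolyvaginHeegnerData Dt H.β ι 1)
    (hPd : d₁.toGeomPoints d₁.derivedPoint = toGeomPoints (W.baseChange K) P)
    (hcert : CertificateAt Dt H.β ι 3 0) : BSDp W 3 := by
  haveI : Fact (Nat.Prime 3) := ⟨Nat.prime_three⟩
  have ht : padicValNat 3 W.tamagawaProduct = 0 := padicValNat.eq_zero_of_not_dvd htam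
  exact bsdp_three_of_certificateAt_of_globalDivisibility W K Dt H ι P hGZ hKo hSk hGZK hmod hMc hMcU hX hram
    hK hodd hHN hP hc hLt Wd Cd hWd d₁ hPd hcert (Nat.zero_le _)
    (globalDivisibility_of_padicValNat_tamagawaProduct_eq_zero ht)

end Summit.BirchSwinnertonDyer.Rank1Residual.X11b.Three.Koly

end
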